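import Mathlib.RingTheory.Flat.EquationalCriterion
import Mathlib.RingTheory.LocalRing.Module
import Mathlib.RingTheory.TensorProduct.DirectLimitFG
import Mathlib.LinearAlgebra.TensorProduct.Vanishing
import Mathlib.LinearAlgebra.TensorProduct.Finiteness
import Mathlib.RingTheory.Finiteness.Prod
import HarnessLib

/-!
# Universally injective module maps

Topic: `Literature/RingTheory/Flat`. A map of `R`-modules `f : M → N` is *universally injective*
if `f ⊗ id_Q : M ⊗ Q → N ⊗ Q` is injective for every `R`-module `Q` (Stacks, Tag 058I). By the
criteria of Stacks, Tag 058K this is equivalent to the equational condition (3): whenever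
`f(xᵢ) = ∑ⱼ aᵢⱼ yⱼ` (`xᵢ ∈ M`, `yⱼ ∈ N`, `aᵢⱼ ∈ R`, finitely many) there are `zⱼ ∈ M` with
`xᵢ = ∑ⱼ aᵢⱼ zⱼ`. We DEFINE universal injectivity by this condition — it does not quantify over
modules, so it is universe-free — and prove that it implies injectivity of `f ⊗ Q` for `Q` in any
universe (Tag 058K, (3) ⇒ (1): reduce to a finitely generated submodule of `N` in which the
tensor already vanishes, `TensorProduct.eq_zero_of_fg_of_subtype_eq_zero`, then apply the
equational criterion for vanishing of tensors, `TensorProduct.vanishesTrivially_of_sum_tmul_eq_zero`).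
Then the standard permanence properties (Tags 05CJ, 058L) and More on Flatness, Lemma 38.7.5
= Tag 05FQ, an ingredient of the induction step (Tag 05I3) of Raynaud–Gruson flattening:
**over a local ring, a map `u : M → N` from a finite free module to a flat module which is
injective modulo the maximal ideal is universally injective** — by Lazard's factorisation of
maps into flat modules through finite free modules (Mathlib
`Module.Flat.exists_factorization_of_comp_eq_zero_of_free`) and the splitting criterion over local
rings (Mathlib `IsLocalRing.split_injective_iff_lTensor_residueField_injective`).

* `IsUniversallyInjective f` — the definition (Tag 058K (3));
* `IsUniversallyInjective.injective`, `.of_retraction`, `.of_comp`, `.comp`;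
* `IsUniversallyInjective.rTensor_injective`, `.lTensor_injective` — **Tag 058K (3) ⇒ (1)**;
* `isUniversallyInjective_of_lTensor_residueField_injective` — **Tag 05FQ.**

## References

* The Stacks Project, Tags 058I, 058K, 058L, 05CJ (Algebra, §10.82) and Tag 05FQ (More on
  Flatness, Lemma 38.7.5). [StacksProject]
* M. Raynaud, L. Gruson, *Critères de platitude et de projectivité*, Invent. Math. 13 (1971),
  Première partie, §2. [RaynaudGruson1971]
-/

namespace Literature.RingTheory.Flat

universe u

open TensorProduct LinearMap Function

variable {R : Type u} [CommRing R]
variable {M : Type*} [AddCommGroup M] [Module R M]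
variable {N : Type*} [AddCommGroup N] [Module R N]
variable {P : Type*} [AddCommGroup P] [Module R P]

/-- **Universally injective module map** (Stacks, Tag 058I), defined by the equational
criterion of Stacks, Tag 058K (3): whenever `f(xᵢ) = ∑ⱼ aᵢⱼ yⱼ` for finitely many `xᵢ ∈ M`,
`yⱼ ∈ N`, `aᵢⱼ ∈ R`, there are `zⱼ ∈ M` with `xᵢ = ∑ⱼ aᵢⱼ zⱼ`. Equivalent to the injectivity
of `f ⊗ Q` for every `R`-module `Q` (`IsUniversallyInjective.rTensor_injective` and Tag 058K).
[cite: StacksProject, Tag 058K (3)] -/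
def IsUniversallyInjective (f : M →ₗ[R] N) : Prop :=
  ∀ ⦃ι κ : Type⦄ [Fintype ι] [Fintype κ] (x : ι → M) (y : κ → N) (a : ι → κ → R),
    (∀ i, f (x i) = ∑ j, a i j • y j) → ∃ z : κ → M, ∀ i, x i = ∑ j, a i j • z j

namespace IsUniversallyInjective

variable {f : M →ₗ[R] N} {g : N →ₗ[R] P}

/-- A universally injective map is injective. [cite: StacksProject, Tag 058I] -/
theorem injective (hf : IsUniversallyInjective f) : Function.Injective f := by
  rw [injective_iff_map_eq_zero]
  intro m hm
  obtain ⟨z, hz⟩ := hf (ι := Unit) (κ := Empty) (fun _ => m) Empty.elim (fun _ j => j.elim)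
    (fun _ => by simp [hm])
  simpa using hz ()

/-- A map with a retraction is universally injective (Stacks, Tag 058L). [cite: StacksProject, Tag 058L] -/
theorem of_retraction (r : N →ₗ[R] M) (hr : r ∘ₗ f = LinearMap.id) : IsUniversallyInjective f := by
  intro ι κ _ _ x y a h
  refine ⟨fun j => r (y j), fun i => ?_⟩
  have := congrArg r (h i)
  rw [← LinearMap.comp_apply, hr, LinearMap.id_apply] at this
  rw [this, map_sum]
  simp_rw [map_smul]

/-- If `g ∘ f` is universally injective then so is `f` (Stacks, Tag 05CJ).
[cite: StacksProject, Tag 05CJ] -/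
theorem of_comp (hgf : IsUniversallyInjective (g ∘ₗ f)) : IsUniversallyInjective f := by
  intro ι κ _ _ x y a h
  exact hgf x (fun j => g (y j)) a fun i => by
    rw [LinearMap.comp_apply, h i, map_sum]
    simp_rw [map_smul]

/-- A composition of universally injective maps is universally injective.
[cite: StacksProject, Tag 058H] -/
theorem comp (hg : IsUniversallyInjective g) (hf : IsUniversallyInjective f) :
    IsUniversallyInjective (g ∘ₗ f) := by
  intro ι κ _ _ x y a h
  obtain ⟨z', hz'⟩ := hg (fun i => f (x i)) y a fun i => h i
  exact hf x z' a hz'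

/-- **Stacks, Tag 058K, (3) ⇒ (1): a universally injective map stays injective after any base
change** `- ⊗ Q`. Proof: for `t = ∑ xᵢ ⊗ qᵢ` in the kernel, the tensor `∑ f(xᵢ) ⊗ qᵢ` already
vanishes in `N' ⊗ Q` for a finitely generated `N' ⊆ N` containing the `f(xᵢ)`; writing
`f(xᵢ) = ∑ aᵢⱼ yⱼ` in generators `yⱼ` of `N'`, the vanishing of `∑ⱼ yⱼ ⊗ (∑ᵢ aᵢⱼ qᵢ)` is
witnessed by the equational criterion (`qⱼ' = ∑ₗ bⱼₗ wₗ`, `∑ⱼ bⱼₗ yⱼ = 0`); the criterion (3)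
applied to the relations `f(xᵢ) = ∑ aᵢⱼ yⱼ`, `f(0) = ∑ⱼ bⱼₗ yⱼ` gives `zⱼ` with `xᵢ = ∑ aᵢⱼ zⱼ`,
`∑ⱼ bⱼₗ zⱼ = 0`, whence `t = ∑ₗ (∑ⱼ bⱼₗ zⱼ) ⊗ wₗ = 0`. [cite: StacksProject, Tag 058K] -/
theorem rTensor_injective (hf : IsUniversallyInjective f) (Q : Type*) [AddCommGroup Q]
    [Module R Q] : Function.Injective (f.rTensor Q) := by
  classical
  rw [injective_iff_map_eq_zero]
  intro t ht
  obtain ⟨s, rfl⟩ := TensorProduct.exists_finset t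
  -- index the pure tensors by `Fin n`
  let x : Fin s.card → M := fun i => ((s.equivFin.symm i : s) : M × Q).1
  let q : Fin s.card → Q := fun i => ((s.equivFin.symm i : s) : M × Q).2
  have hts : ∑ p ∈ s, p.1 ⊗ₜ[R] p.2 = ∑ i, x i ⊗ₜ[R] q i := by
    rw [← Finset.sum_coe_sort]
    exact Fintype.sum_equiv s.equivFin _ _ fun p => by simp [x, q]
  rw [hts] at ht ⊢
  have ht' : ∑ i, f (x i) ⊗ₜ[R] q i = (0 : N ⊗[R] Q) := by
    simpa [map_sum, LinearMap.rTensor_tmul] using ht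
  -- the finitely generated submodule generated by the `f xᵢ`, enlarged so the tensor vanishes
  let P₀ : Submodule R N := Submodule.span R (Set.range (f ∘ x))
  have hP₀ : P₀.FG := Submodule.fg_span (Set.finite_range _)
  have hxP₀ : ∀ i, f (x i) ∈ P₀ := fun i => Submodule.subset_span ⟨i, rfl⟩
  let t₁ : P₀ ⊗[R] Q := ∑ i, (⟨f (x i), hxP₀ i⟩ : P₀) ⊗ₜ[R] q i
  have ht₁ : LinearMap.rTensor Q P₀.subtype t₁ = 0 := by
    simp only [t₁, map_sum, LinearMap.rTensor_tmul, Submodule.subtype_apply]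
    exact ht'
  obtain ⟨P', hPP', hP'fg, ht₁'⟩ := TensorProduct.eq_zero_of_fg_of_subtype_eq_zero hP₀ ht₁
  have hxP' : ∀ i, f (x i) ∈ P' := fun i => hPP' (hxP₀ i)
  have ht₂ : ∑ i, (⟨f (x i), hxP' i⟩ : P') ⊗ₜ[R] q i = (0 : P' ⊗[R] Q) := by
    rw [← ht₁']
    simp only [t₁, map_sum, LinearMap.rTensor_tmul]
    rfl
  -- generators `y` of `P'` and coefficients `a` with `f xᵢ = ∑ aᵢⱼ yⱼ`
  haveI : Module.Finite R P' := Module.Finite.iff_fg.mpr hP'fg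
  obtain ⟨m, y, hy⟩ := Module.Finite.exists_fin (R := R) (M := P')
  have hcoef : ∀ i, ∃ a : Fin m → R, ∑ j, a j • y j = (⟨f (x i), hxP' i⟩ : P') := fun i =>
    (Submodule.mem_span_range_iff_exists_fun R).mp (by rw [hy]; exact Submodule.mem_top)
  choose a ha using hcoef
  -- in `P' ⊗ Q`: `∑ⱼ yⱼ ⊗ qⱼ' = 0` with `qⱼ' = ∑ᵢ aᵢⱼ qᵢ`
  let q' : Fin m → Q := fun j => ∑ i, a i j • q i
  have hsum : ∑ j, y j ⊗ₜ[R] q' j = (0 : P' ⊗[R] Q) := by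
    rw [← ht₂]
    simp_rw [q', ← ha, TensorProduct.sum_tmul, TensorProduct.tmul_sum, TensorProduct.smul_tmul]
    exact Finset.sum_comm
  obtain ⟨k, b, w, hbw, hby⟩ := TensorProduct.vanishesTrivially_of_sum_tmul_eq_zero R hy hsum
  -- apply the criterion to the relations `f xᵢ = ∑ aᵢⱼ yⱼ` and `f 0 = ∑ⱼ bⱼₗ yⱼ`
  have ha' : ∀ i, f (x i) = ∑ j, a i j • (y j : N) := fun i => by
    have := congrArg Subtype.val (ha i)
    simpa using this.symm
  have hby' : ∀ l, (0 : N) = ∑ j, b j l • (y j : N) := fun l => by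
    have := congrArg Subtype.val (hby l)
    simpa using this.symm
  obtain ⟨z, hz⟩ := hf (ι := Fin s.card ⊕ Fin k) (κ := Fin m) (Sum.elim x 0) (fun j => (y j : N))
    (Sum.elim a fun l j => b j l) (by
      rintro (i | l)
      · exact ha' i
      · simpa using hby' l)
  have hxz : ∀ i, x i = ∑ j, a i j • z j := fun i => hz (Sum.inl i)
  have hz0 : ∀ l, ∑ j, b j l • z j = 0 := fun l => (hz (Sum.inr l)).symm
  -- conclude `t = 0`
  calc ∑ i, x i ⊗ₜ[R] q i = ∑ i, (∑ j, a i j • z j) ⊗ₜ[R] q i := by simp_rw [← hxz]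
    _ = ∑ j, z j ⊗ₜ[R] q' j := by
      simp_rw [q', TensorProduct.sum_tmul, TensorProduct.tmul_sum, TensorProduct.smul_tmul]
      exact Finset.sum_comm
    _ = ∑ j, z j ⊗ₜ[R] ∑ l, b j l • w l := by simp_rw [← hbw]
    _ = ∑ l, (∑ j, b j l • z j) ⊗ₜ[R] w l := by
      simp_rw [TensorProduct.sum_tmul, TensorProduct.tmul_sum, TensorProduct.smul_tmul,
        TensorProduct.tmul_smul]
      exact Finset.sum_comm
    _ = 0 := by simp [hz0]

/-- The same for `Q ⊗ -`. [cite: StacksProject, Tag 058K] -/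
theorem lTensor_injective (hf : IsUniversallyInjective f) (Q : Type*) [AddCommGroup Q]
    [Module R Q] : Function.Injective (f.lTensor Q) := by
  have : f.lTensor Q = (TensorProduct.comm R N Q).toLinearMap ∘ₗ f.rTensor Q ∘ₗ
      (TensorProduct.comm R Q M).toLinearMap := by
    ext q m
    simp
  rw [this]
  exact (TensorProduct.comm R N Q).injective.comp
    ((hf.rTensor_injective Q).comp (TensorProduct.comm R Q M).injective)

end IsUniversallyInjective

/-! ## Tag 05FQ: universal injectivity is detected modulo the maximal ideal -/

/-- **Stacks, Tag 05FQ (More on Flatness, Lemma 38.7.5), finite free source.** Let `R` be a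
local ring with residue field `k`, `M` a finite free `R`-module, `N` a flat `R`-module and
`u : M → N` a linear map such that `k ⊗ u : k ⊗ M → k ⊗ N` is injective. Then `u` is universally
injective. Proof (loc. cit., via Lazard): the relations `u(xᵢ) = ∑ aᵢⱼ yⱼ` define a map from a
finite free module into `M ⊕ R^κ` killed by `u ⊕ (yⱼ) : M ⊕ R^κ → N`; as `N` is flat the latter
factors through a finite free `F` by a map `α` killing the relations
(`Module.Flat.exists_factorization_of_comp_eq_zero_of_free`); `φ = α|_M : M → F` is injective
modulo `𝔪` (as `k ⊗ u` is), hence split injective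
(`IsLocalRing.split_injective_iff_lTensor_residueField_injective`), and a retraction `ψ` gives
`zⱼ = ψ(α(0, eⱼ))`. [cite: StacksProject, Tag 05FQ] -/
theorem isUniversallyInjective_of_lTensor_residueField_injective [IsLocalRing R]
    {M N : Type u} [AddCommGroup M] [Module R M] [AddCommGroup N] [Module R N]
    [Module.Finite R M] [Module.Free R M] [Module.Flat R N] (u : M →ₗ[R] N)
    (hu : Function.Injective (u.lTensor (IsLocalRing.ResidueField R))) :
    IsUniversallyInjective u := by
  classical
  intro ι κ _ _ x y a hrel
  haveI : Module.Finite R (κ → R) := Module.Finite.pi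
  haveI : Module.Finite R (ι → R) := Module.Finite.pi
  haveI : Module.Finite R (M × (κ → R)) := inferInstance
  haveI : Module.Free R (M × (κ → R)) := inferInstance
  -- `f₀ = u ⊕ (yⱼ) : M × (κ → R) → N` kills the relations `l : (ι → R) → M × (κ → R)`
  let f₀ : (M × (κ → R)) →ₗ[R] N := u.coprod (Fintype.linearCombination R y)
  let l : (ι → R) →ₗ[R] (M × (κ → R)) :=
    (Fintype.linearCombination R x).prod (-(Fintype.linearCombination R fun i => (a i : κ → R)))
  have hli : ∀ i, l (Pi.single i 1) = (x i, -(a i : κ → R)) := fun i => by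
    simp only [l, LinearMap.prod_apply, Function.prod, LinearMap.neg_apply,
      Fintype.linearCombination_apply_single, one_smul]
  have hl : f₀ ∘ₗ l = 0 := by
    apply (Pi.basisFun R ι).ext
    intro i
    rw [LinearMap.comp_apply, LinearMap.zero_apply, Pi.basisFun_apply, hli i]
    simp only [f₀, LinearMap.coprod_apply, map_neg, Fintype.linearCombination_apply, hrel i,
      add_neg_eq_zero]
  obtain ⟨k, α, g, hfg, hαl⟩ := Module.Flat.exists_factorization_of_comp_eq_zero_of_free hl
  -- `φ = α ∘ inl` is injective modulo `𝔪`, hence a split injection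
  let φ : M →ₗ[R] (Fin k →₀ R) := α ∘ₗ LinearMap.inl R M (κ → R)
  have hgφ : g ∘ₗ φ = u := by
    rw [← LinearMap.comp_assoc, ← hfg]
    exact LinearMap.coprod_inl _ _
  have hφ : Function.Injective (φ.lTensor (IsLocalRing.ResidueField R)) := by
    have hcomp : u.lTensor (IsLocalRing.ResidueField R) =
        g.lTensor (IsLocalRing.ResidueField R) ∘ₗ φ.lTensor (IsLocalRing.ResidueField R) := by
      rw [← LinearMap.lTensor_comp, hgφ]
    have hu' := hu
    rw [hcomp, LinearMap.coe_comp] at hu'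
    exact Function.Injective.of_comp hu'
  obtain ⟨ψ, hψ⟩ := (IsLocalRing.split_injective_iff_lTensor_residueField_injective φ).mpr hφ
  -- the relations in `F`: `α (xᵢ, 0) = ∑ⱼ aᵢⱼ α (0, eⱼ)`
  have hαi : ∀ i, α (x i, 0) = ∑ j, a i j • α ((0 : M), (Pi.single j 1 : κ → R)) := fun i => by
    have h0 : α (l (Pi.single i 1)) = 0 := by
      rw [← LinearMap.comp_apply, hαl, LinearMap.zero_apply]
    have hsplit : ((x i, -(a i : κ → R)) : M × (κ → R)) = (x i, 0) - (0, (a i : κ → R)) := by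
      ext <;> simp
    rw [hli i, hsplit, map_sub, sub_eq_zero] at h0
    have hai : ((0 : M), (a i : κ → R)) = ∑ j, a i j • ((0 : M), (Pi.single j 1 : κ → R)) := by
      ext
      · simp [Prod.fst_sum]
      · simp [Prod.snd_sum, Finset.sum_apply, Pi.single_apply]
    rw [h0, hai, map_sum]
    simp_rw [map_smul]
  refine ⟨fun j => ψ (α ((0 : M), (Pi.single j 1 : κ → R))), fun i => ?_⟩
  have hxi : x i = ψ (φ (x i)) := by
    rw [← LinearMap.comp_apply, hψ, LinearMap.id_apply]
  rw [hxi]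
  change ψ (α (LinearMap.inl R M (κ → R) (x i))) = _
  rw [LinearMap.inl_apply, hαi, map_sum]
  simp_rw [map_smul]

end Literature.RingTheory.Flat
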